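import Summits.CriticalPhenomena.Ising3DConformalLimit.Theses.FKParityRobustness
import Summits.CriticalPhenomena.Ising3DConformalLimit.Theorems.FKParityRobustnessDefs
import Summits.CriticalPhenomena.Ising3DConformalLimit.Theorems.FKParityRobustnessParityBoundCurrents
import Summits.CriticalPhenomena.Ising3DConformalLimit.Theorems.FKParityRobustnessParityRobustMergingGrimmettJanson
import Summits.CriticalPhenomena.Ising3DConformalLimit.Theorems.FKParityRobustnessParityRobustMergingEvenSubgraphCount
import Summits.CriticalPhenomena.Ising3DConformalLimit.Theorems.FKParityRobustnessParityRobustMergingFKTransfer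
import HarnessLib

/-!
# The parity bound `U₄ ≤ −2 · E_FK[u_A]`: item `ParityBound` (stmt-CriticalPhenomena-8466)
# of route `FKParityRobustness`

On every finite graph `G = (V, E)`, for `β ≥ 0` and four distinct vertices `a : Fin 4 → V`
(`A = {aᵢ}`), the Ursell function of the free-boundary, zero-field Ising model satisfies

  `U₄^free_{G,β}(a) ≤ −2 ∫ u_a dφ`,   `φ = rcMeasure G (fkIsingParam β) 2 ∅` (free FK-Ising),

where `u_a(ω)` is the PARITY ROBUSTNESS of `ω`: the fraction of the `T`-joins of `A` inside `ω`
(`F ⊆ ω ∩ E` with odd-degree set exactly `A`) that keep all four `aᵢ` in one component.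

Proof.  Write `Z(S) = ∑_{∂n = S} w_β(n)` (current sums), `t = tanh β`,
`Z_t(A; C) = ∑ {t^{|F|} : F a T-join of A in G joining all aᵢ}` (`zMass … JoinsAll`),
`Z_t(∅) = ∑_{F even} t^{|F|}`.
* Ising side: `U₄ = Z(A)/Z(∅) − Σ_π Z(aᵢaⱼ)Z(aₖaₗ)/Z(∅)²` (`connectedFour_isingMeasure_free_eq`,
  random-current representation `⟨σ_S⟩ = Z(S)/Z(∅)`), and
  `Z(A)Z(∅) + 2 cosh^{|E|} Z_t(A;C) Z(∅) ≤ Σ_π Z Z` (`currentSum_parity_ineq`, real form of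
  `currentSum_four_add_oddPart_le` of the companion file `…ParityBoundCurrents`: the random-current
  identity for `U₄`, switching, `odd(n₁) ⊆ n₁ + n₂`, and the `sinh/cosh` law of the odd part),
  `Z(∅) = cosh^{|E|} Z_t(∅)` (`currentSum_empty_eq_cosh_pow_mul`); hence
  `U₄ ≤ −2 Z_t(A;C)/Z_t(∅)`.
* FK side: `∫ u_a dφ = Z_t(A;C)/Z_t(∅)` by the sourced Grimmett–Janson identity of the tree
  (`grimmettJanson_identity`, fed with the even-subgraph count `card_evenSubgraphs_mul_two_pow`)
  at `P = C`, and at `A = ∅, P = ⊤` for `Z_RC = 2^{|V|}(1 − p/2)^{|E|} Z_t(∅)`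
  (`t = p/(2 − p)`, `tanh_eq_fkIsingParam_div`).

* `symmDiff_four_eq_image` — `{a₀} ∆ {a₁} ∆ {a₂} ∆ {a₃} = {aᵢ}` for distinct `aᵢ`;
* `currentSum_parity_ineq`, `currentSum_empty_eq_cosh_pow_mul` — real forms of the companion
  file's `ℝ≥0∞` statements;
* `connectedFour_isingMeasure_free_eq` — `U₄` through current sums;
* `parityBound_proof` — the item, verbatim.

Theorem-only file.  References: M. Aizenman, Comm. Math. Phys. 86 (1982), Prop. 5.1
[AizenmanCMP1982]; H. Duminil-Copin, arXiv:1607.06933, §2.1, Remark 3.4, eq. (24)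
[DuminilCopin2016]; G. Grimmett, S. Janson, Electron. J. Combin. 16 (2009), Thm 3.1
[GrimmettJanson2007]; U. T. Hansen, J. Jiang, F. R. Klausen, arXiv:2506.10765, §2
[HansenJiangKlausen2025]; G. Grimmett, *Probability on Graphs* (2018), Thm 8.65–8.66 [Grimmett2018].
-/

noncomputable section

open MeasureTheory Finset
open scoped symmDiff ENNReal
open Literature.Probability.LatticeModels
open Summit.CriticalPhenomena.Ising3DConformalLimit.Cruxes.ParityRobustMerging.PlaquetteXorSurgery

namespace Summit.CriticalPhenomena.Ising3DConformalLimit.Theorems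

open scoped Classical

section Real

variable {V : Type*} [Fintype V] [DecidableEq V] (G : SimpleGraph V) [DecidableRel G.Adj]

omit [Fintype V] in
/-- For four distinct vertices, `{a₀} ∆ {a₁} ∆ {a₂} ∆ {a₃} = {a₀, a₁, a₂, a₃}`. [folklore] -/
theorem symmDiff_four_eq_image {a : Fin 4 → V} (ha : Function.Injective a) :
    ({a 0} : Finset V) ∆ ({a 1} ∆ ({a 2} ∆ {a 3})) = univ.image a := by
  have h01 := ha.ne (show (0 : Fin 4) ≠ 1 by decide)
  have h02 := ha.ne (show (0 : Fin 4) ≠ 2 by decide)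
  have h03 := ha.ne (show (0 : Fin 4) ≠ 3 by decide)
  have h12 := ha.ne (show (1 : Fin 4) ≠ 2 by decide)
  have h13 := ha.ne (show (1 : Fin 4) ≠ 3 by decide)
  have h23 := ha.ne (show (2 : Fin 4) ≠ 3 by decide)
  ext v
  simp only [Finset.mem_symmDiff, Finset.mem_singleton, Finset.mem_image, Finset.mem_univ,
    true_and]
  constructor
  · intro h
    by_cases e0 : v = a 0
    · exact ⟨0, e0.symm⟩
    by_cases e1 : v = a 1
    · exact ⟨1, e1.symm⟩
    by_cases e2 : v = a 2
    · exact ⟨2, e2.symm⟩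
    by_cases e3 : v = a 3
    · exact ⟨3, e3.symm⟩
    exfalso
    tauto
  · rintro ⟨i, rfl⟩
    fin_cases i <;>
      simp [h01, h02, h03, h12, h13, h23, h01.symm, h02.symm, h03.symm, h12.symm, h13.symm,
        h23.symm]

/-- **The current-side parity inequality, real form.** For `β ≥ 0` and four distinct vertices
`aᵢ`, with `Z(S) = currentSum G β S`, `t = tanh β` and `Z_t(A; C)` the loop-O(1) mass of the
`T`-joins of `A = {aᵢ}` joining all four (`zMass`):
`Z(A) Z(∅) + 2 cosh(β)^{|E|} Z_t(A; C) Z(∅) ≤ Z(a₀a₁)Z(a₂a₃) + Z(a₀a₂)Z(a₁a₃) + Z(a₀a₃)Z(a₁a₂)`,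
i.e. `P^{A,∅}[all aᵢ joined in n₁ + n₂] ≥ P^A[all aᵢ joined in odd(n₁)]` dressed with the
switching lemma (Aizenman 1982; Duminil-Copin 2016, §4.3). [cite: AizenmanCMP1982, Prop. 5.1] -/
theorem currentSum_parity_ineq {β : ℝ} (hβ : 0 ≤ β) {a : Fin 4 → V} (ha : Function.Injective a) :
    currentSum G β (univ.image a) * currentSum G β ∅ +
        2 * (Real.cosh β ^ #G.edgeFinset * zMass G (Real.tanh β) a (fun F => JoinsAll a F)) *
          currentSum G β ∅ ≤
      currentSum G β ({a 0} ∆ {a 1}) * currentSum G β ({a 2} ∆ {a 3}) +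
        currentSum G β ({a 0} ∆ {a 2}) * currentSum G β ({a 1} ∆ {a 3}) +
        currentSum G β ({a 0} ∆ {a 3}) * currentSum G β ({a 1} ∆ {a 2}) := by
  have hK : ∀ _e : G.edgeFinset, 0 ≤ β := fun _ => hβ
  have ht : 0 ≤ Real.tanh β := by
    rw [Real.tanh_eq_sinh_div_cosh]
    exact div_nonneg (Real.sinh_nonneg_iff.2 hβ) (Real.cosh_pos β).le
  have h := currentSum_four_add_oddPart_le (G := G) hβ a
  rw [symmDiff_four_eq_image ha, tsum_sources_eweight_joinsAll_eq hβ a] at h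
  have hZ : ∀ S, ecurrentSum (fun _ : G.edgeFinset => β) S = ENNReal.ofReal (currentSum G β S) :=
    fun S => by rw [currentSum_eq_wcurrentSum]; exact ecurrentSum_eq_ofReal hK S
  have hnn : ∀ S, 0 ≤ currentSum G β S := fun S => currentSum_nonneg G hβ S
  have hc : 0 ≤ Real.cosh β ^ #G.edgeFinset * zMass G (Real.tanh β) a (fun F => JoinsAll a F) :=
    mul_nonneg (pow_nonneg (Real.cosh_pos β).le _) (zMass_nonneg G ht a _)
  simp only [hZ] at h
  have h2 : (0 : ℝ) ≤ 2 := by norm_num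
  rw [← ENNReal.ofReal_ofNat 2, ← ENNReal.ofReal_mul (hnn _), ← ENNReal.ofReal_mul (hnn _),
    ← ENNReal.ofReal_mul (hnn _), ← ENNReal.ofReal_mul (hnn _), ← ENNReal.ofReal_mul hc,
    ← ENNReal.ofReal_mul h2,
    ← ENNReal.ofReal_add (mul_nonneg (hnn _) (hnn _)) (mul_nonneg h2 (mul_nonneg hc (hnn _))),
    ← ENNReal.ofReal_add (mul_nonneg (hnn _) (hnn _)) (mul_nonneg (hnn _) (hnn _)),
    ← ENNReal.ofReal_add (add_nonneg (mul_nonneg (hnn _) (hnn _)) (mul_nonneg (hnn _) (hnn _)))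
      (mul_nonneg (hnn _) (hnn _)),
    ENNReal.ofReal_le_ofReal_iff (add_nonneg (add_nonneg (mul_nonneg (hnn _) (hnn _))
      (mul_nonneg (hnn _) (hnn _))) (mul_nonneg (hnn _) (hnn _)))] at h
  linarith

/-- `Z(∅) = cosh(β)^{|E|} ∑_{F even} tanh(β)^{|F|}` (real form of `ecurrentSum_empty_eq_ofReal`).
[cite: DuminilCopin2016, Remark 3.4] -/
theorem currentSum_empty_eq_cosh_pow_mul {β : ℝ} (hβ : 0 ≤ β) :
    currentSum G β ∅ = Real.cosh β ^ #G.edgeFinset *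
      ∑ F ∈ evenSubgraphs G Set.univ, Real.tanh β ^ #F := by
  have hK : ∀ _e : G.edgeFinset, 0 ≤ β := fun _ => hβ
  have ht : 0 ≤ Real.tanh β := by
    rw [Real.tanh_eq_sinh_div_cosh]
    exact div_nonneg (Real.sinh_nonneg_iff.2 hβ) (Real.cosh_pos β).le
  have h := ecurrentSum_empty_eq_ofReal (G := G) hβ
  rw [currentSum_eq_wcurrentSum, ← toReal_ecurrentSum hK, h, ENNReal.toReal_ofReal]
  exact mul_nonneg (pow_nonneg (Real.cosh_pos β).le _)
    (Finset.sum_nonneg fun F _ => pow_nonneg ht _)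

end Real

section Main

variable {V : Type*} [Fintype V] [DecidableEq V] (G : SimpleGraph V) [DecidableRel G.Adj]

/-- **Ursell's four-point function through current sums**: for the free-boundary zero-field Ising
model on a finite graph,
`U₄(a) = Z(A)/Z(∅) − Σ_π (Z(a_i a_j)/Z(∅)) (Z(a_k a_l)/Z(∅))` with `Z(S) = ∑_{∂n = S} w_β(n)`,
`A = {a₀} ∆ {a₁} ∆ {a₂} ∆ {a₃}` (random-current representation `⟨σ_S⟩ = Z(S)/Z(∅)`,
Duminil-Copin 2016, eq. (2.2)). [cite: DuminilCopin2016, §2.1] -/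
theorem connectedFour_isingMeasure_free_eq (β : ℝ) (a : Fin 4 → V) :
    connectedFour (isingMeasure G univ β 0 .free) spinAt a =
      currentSum G β ({a 0} ∆ ({a 1} ∆ ({a 2} ∆ {a 3}))) / currentSum G β ∅
        - currentSum G β ({a 0} ∆ {a 1}) / currentSum G β ∅ *
            (currentSum G β ({a 2} ∆ {a 3}) / currentSum G β ∅)
        - currentSum G β ({a 0} ∆ {a 2}) / currentSum G β ∅ *
            (currentSum G β ({a 1} ∆ {a 3}) / currentSum G β ∅)
        - currentSum G β ({a 0} ∆ {a 3}) / currentSum G β ∅ *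
            (currentSum G β ({a 1} ∆ {a 2}) / currentSum G β ∅) := by
  have ha : a = ![a 0, a 1, a 2, a 3] := by
    ext i; fin_cases i <;> rfl
  have h2 := isingTwoPoint_free_eq_currentSum_div_holds G β
  conv_lhs => rw [ha]
  simp only [connectedFour, nPoint_isingMeasure, twoPoint_isingMeasure, Matrix.cons_val]
  rw [isingExpect_spinMonomial_four_eq, h2, h2, h2, h2, h2, h2]

/-- **Item `ParityBound` (stmt-CriticalPhenomena-8466) of route `FKParityRobustness`.**  On every
finite graph `G`, for `β ≥ 0` and four distinct vertices `a : Fin 4 → V`,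
`U₄^free_{G,β}(a) ≤ −2 · ∫ u_a dφ`, where `φ = rcMeasure G (fkIsingParam β) 2 ∅` is the free
FK-Ising measure and `u_a(ω)` the fraction of the `T`-joins of `A = {aᵢ}` inside `ω` keeping all
four `aᵢ` in one component (the PARITY ROBUSTNESS).  Proof: `U₄ Z(∅)² = Z(A)Z(∅) − Σ_π Z Z`
(`connectedFour_isingMeasure_free_eq`) `≤ −2 cosh^{|E|} Z_t(A;C) Z(∅)` (`currentSum_parity_ineq`:
random-current identity for `U₄`, switching, `odd(n₁) ⊆ n₁ + n₂`, and the `sinh/cosh` expansion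
of the odd part of a current), `Z(∅) = cosh^{|E|} Z_t(∅)` (`currentSum_empty_eq_cosh_pow_mul`), and
on the FK side `∫ u_a dφ = Z_t(A;C)/Z_t(∅)` by the sourced Grimmett–Janson identity
(`grimmettJanson_identity` with the even-subgraph count `card_evenSubgraphs_mul_two_pow`, both in
tree) at `P = C` and at `A = ∅`.
[cite: AizenmanCMP1982, Prop. 5.1] [cite: GrimmettJanson2007, Thm 3.1] -/
theorem parityBound_proof :
    Summit.CriticalPhenomena.Ising3DConformalLimit.Theses.FKParityRobustness.ParityBound := by
  intro V _ _ G _ β hβ a ha φ sol u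
  -- parameters
  have hp : fkIsingParam β ∈ Set.Icc (0 : ℝ) 1 := fkIsingParam_mem_Icc hβ
  have h2 : (0 : ℝ) < 2 := two_pos
  have hZ := rcPartitionFunction_pos G hp h2 (∅ : Set V)
  have htp : Real.tanh β = fkIsingParam β / (2 - fkIsingParam β) := tanh_eq_fkIsingParam_div β
  have ht : 0 ≤ Real.tanh β := by
    rw [Real.tanh_eq_sinh_div_cosh]
    exact div_nonneg (Real.sinh_nonneg_iff.2 hβ) (Real.cosh_pos β).le
  have hGJ := grimmettJanson_identity G (card_evenSubgraphs_mul_two_pow G) hp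
  set T0 : ℝ := ∑ F ∈ evenSubgraphs G Set.univ, Real.tanh β ^ #F with hT0
  set TC : ℝ := zMass G (Real.tanh β) a (fun F => JoinsAll a F) with hTC
  have hT0pos : 0 < T0 :=
    Finset.sum_pos' (fun F _ => pow_nonneg ht _)
      ⟨∅, empty_mem_evenSubgraphs G _, by rw [Finset.card_empty, pow_zero]; exact one_pos⟩
  have hq : (0 : ℝ) < 2 ^ Fintype.card V * (1 - fkIsingParam β / 2) ^ #G.edgeFinset := by
    have : 0 < 1 - fkIsingParam β / 2 := by linarith [hp.2]
    positivity
  -- (FK 1) the random-cluster partition function through the Grimmett–Janson identity at `A = ∅`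
  have hZRC : rcPartitionFunction G (fkIsingParam β) 2 ∅ =
      2 ^ Fintype.card V * (1 - fkIsingParam β / 2) ^ #G.edgeFinset * T0 := by
    have step := hGJ ∅ (fun _ => True)
    simp only [Finset.filter_true] at step
    rw [← htp] at step
    rw [hT0, ← step]
    unfold rcPartitionFunction
    refine Finset.sum_congr rfl fun ω _ => ?_
    rw [div_self, mul_one]
    exact Nat.cast_ne_zero.2 (Finset.card_pos.2 ⟨∅, empty_mem_evenSubgraphs G _⟩).ne'
  -- (FK 2) the integral of `u`
  have hsol : ∀ ω, sol ω = tJoins G ω (univ.image a) := fun ω => rfl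
  have hu : ∀ ω, u ω =
      (#((tJoins G ω (univ.image a)).filter fun F => JoinsAll a F) : ℝ) / #(evenSubgraphs G ω) := by
    intro ω
    simp only [u]
    rw [hsol ω, card_filter_bind_pure_coe _ _ (fun F => JoinsAll a F) ?_]
    · rcases (tJoins G ω (univ.image a)).eq_empty_or_nonempty with hemp | ⟨F₀, hF₀⟩
      · rw [hemp]
        simp
      · rw [card_tJoins_eq_card_evenSubgraphs G hF₀]
    · intro F
      rfl
  have hI : ∫ ω, u ω ∂φ = TC / T0 := by
    have step1 : ∫ ω, u ω ∂φ = ∑ ω' ∈ G.edgeFinset.powerset,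
        rcWeight G (fkIsingParam β) 2 ∅ ω' / rcPartitionFunction G (fkIsingParam β) 2 ∅ * u ↑ω' :=
      integral_rcMeasure G hp h2 ∅ u
    have step2 : ∀ ω' ∈ G.edgeFinset.powerset,
        rcWeight G (fkIsingParam β) 2 ∅ ω' / rcPartitionFunction G (fkIsingParam β) 2 ∅ * u ↑ω' =
        rcWeight G (fkIsingParam β) 2 ∅ ω' *
          ((#((tJoins G (↑ω' : Set (Sym2 V)) (univ.image a)).filter fun F => JoinsAll a F) : ℝ) /
            (#(evenSubgraphs G (↑ω' : Set (Sym2 V))) : ℝ)) /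
          rcPartitionFunction G (fkIsingParam β) 2 ∅ := by
      intro ω' _
      rw [hu]
      ring
    have step3 := hGJ (univ.image a) (fun F => JoinsAll a F)
    rw [← htp] at step3
    rw [step1, Finset.sum_congr rfl step2, ← Finset.sum_div, step3, hZRC, hTC,
      mul_div_mul_left _ _ hq.ne']
    rfl
  -- (Ising) the current-side inequality
  have hU := connectedFour_isingMeasure_free_eq G β a
  have hineq := currentSum_parity_ineq G hβ ha
  have hZ0 := currentSum_empty_eq_cosh_pow_mul G hβ
  have hZ0pos : 0 < currentSum G β ∅ := currentSum_empty_pos' G β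
  rw [symmDiff_four_eq_image ha] at hU
  rw [hI, hU]
  have hc : 0 < Real.cosh β ^ #G.edgeFinset := pow_pos (Real.cosh_pos β) _
  rw [show currentSum G β (univ.image a) / currentSum G β ∅
      - currentSum G β ({a 0} ∆ {a 1}) / currentSum G β ∅ *
          (currentSum G β ({a 2} ∆ {a 3}) / currentSum G β ∅)
      - currentSum G β ({a 0} ∆ {a 2}) / currentSum G β ∅ *
          (currentSum G β ({a 1} ∆ {a 3}) / currentSum G β ∅)
      - currentSum G β ({a 0} ∆ {a 3}) / currentSum G β ∅ *
          (currentSum G β ({a 1} ∆ {a 2}) / currentSum G β ∅)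
      = (currentSum G β (univ.image a) * currentSum G β ∅
          - (currentSum G β ({a 0} ∆ {a 1}) * currentSum G β ({a 2} ∆ {a 3}) +
              currentSum G β ({a 0} ∆ {a 2}) * currentSum G β ({a 1} ∆ {a 3}) +
              currentSum G β ({a 0} ∆ {a 3}) * currentSum G β ({a 1} ∆ {a 2}))) /
        (currentSum G β ∅ * currentSum G β ∅) by field_simp; ring,
    div_le_iff₀ (mul_pos hZ0pos hZ0pos)]
  have key : -(2 * (TC / T0)) * (currentSum G β ∅ * currentSum G β ∅) =
      -(2 * (Real.cosh β ^ #G.edgeFinset * TC) * currentSum G β ∅) := by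
    rw [hZ0]
    field_simp
    ring
  rw [key]
  linarith

end Main

end Summit.CriticalPhenomena.Ising3DConformalLimit.Theorems

end
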